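/-
Origin: expansion seat `planner-pub-hodgecm-toy2-g3-0`, handover #1b 2026-08-18T06:26:03Z (`HOME/pub-hodgecm-toy2-g3/lean/Toy2g3/ToyTruncAlg.lean`, md5 c15a0ed9, 175 lines);
landed by the gen-7 packager in gate run 25 as `HodgeCM/Model/Toy/ToyTruncAlg.lean` (import ^import Toy2g3\.TruncAlg\b→import HodgeCM.Model.TruncAlg ×1).
-/
/-
Copyright: pub-hodgecm formalisation cell (harness21, 2026). New file (not vendored).
Origin: HOME/pub-hodgecm-toy2-g3/lean/Toy2g3/ToyTruncAlg.lean — session planner-pub-hodgecm-toy2-g3-0 (unit pub-hodgecm-toy2-g3,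
CONSISTENCY seat 2, part (6a)(i)+(ii), generation 3).  WIP module `Toy2g3.ToyTruncAlg`; intended final place
`HodgeCM/Model/Toy/ToyTruncAlg.lean` (module `HodgeCM.Model.Toy.ToyTruncAlg`; kind L5 toy model / consistency witness).
WIP import to rewrite on landing: `import Toy2g3.TruncAlg` ↦ `import HodgeCM.Model.TruncAlg` (this seat, same handover).
-/
import Summits.HodgeConjecture.HodgeCM.Model.TruncAlg
import Summits.HodgeConjecture.HodgeCM.Model.Toy.ToyOpenInputs
import Summits.HodgeConjecture.HodgeCM.Model.Toy.ToyFFacts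

/-!
# A second model of the 28 facts: the codimension-two truncation of the toy universe

`truncModel := toyModel.truncAlg` keeps every primitive of the exterior CM-model `toyModel` (sibling seat toy;
`toyModel_modelAxioms`, gate run 22) except the spans of algebraic classes, which are cut off at codimension two
(`HodgeCM.Model.TruncAlg`).  Since `toyModel` has `tr = 0`, the generic results of `HodgeCM.Model.TruncAlg` apply with
no hypothesis, and every input of them (`ModelAxioms`, N1–N4, F5, `W_RK4`, `PohlmannSpan`/`PohlmannBasis`) is a theorem of
`toyModel`.  Truth table of `truncModel` (`truncModel_profile`):

* TRUE:  `ModelAxioms` (all 28), `PohlmannSpan`, `PohlmannBasis`, `W_RK4` (every rank-four face line algebraic),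
         `Lemma81`, N1 `Fact_cupExterior`, N2 `Fact_cup_hodge`, N3 `Fact_pull_H0`, N4 `Fact_hodge_F0`, F5 `Fact_cupAssoc`;
* FALSE: `Qw8Sufficiency`, `FaceReduction`, `HC_CM`, and (as in every universe with `tr = 0`) `RealisationExistsPerL`,
         `RealisationExistsFace`, `PeriodThmF`, `PerL44`, `PerL`, `OpenInputs`.

Compare `toyModel` (`HodgeCM.Toy.toyModel_profile`): there `Qw8Sufficiency`, `FaceReduction`, `HC_CM` are TRUE.  Hence:

* `qw8Sufficiency_independent`, `not_qw8Sufficiency_of_other_inputs` — **the open input `qw8_sufficiency` carries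
  content**: it is not a consequence of `ModelAxioms ∧ PohlmannSpan ∧ PohlmannBasis ∧ W_RK4 ∧ Lemma81` (a separating
  model; the gen-2 table `TOY2-G2.md` had "not separable in the exterior family");
* `hc_cm_independent_of_modelAxioms`, `not_hc_cm_of_faces_and_pohlmann` — **two models of the 28 facts with opposite values
  of COR-CM**: the model facts, Pohlmann's theorem and the algebraicity of all rank-four face lines do not imply the Hodge
  conjecture for CM abelian varieties; the [QW8] sufficiency step is where that implication lives;
* `faceReduction_independent` — likewise for the face reduction;
* `truncModel_ne_toyModel` — part (6a)(i) of the consistency brief in the only non-trivial sense available (the axioms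
  quantify over every CM field, so models cannot differ in their CM data; these two differ in `alg` and in `HC_CM`).

F4 `Fact_cupAlg` (all degrees) holds in `toyModel` (`HodgeCM.Toy.fact_cupAlg`) and FAILS in `truncModel` as soon as F7d and
`Fact_dimProd` of `toyModel` are available (`HodgeCM.Universe.not_fact_cupAlg_truncAlg`; instance in
`HodgeCM.Model.Toy.ToyTruncAlgF4`, after `ToyGysinDescent`).
-/

noncomputable section

namespace HodgeCM.Toy

open Universe

/-- **The truncated toy universe**: `toyModel` with `alg X p := 0` for `p ≥ 3`. -/
def truncModel : Universe := toyModel.truncAlg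

/-- (Ported verbatim from the HodgeCMPerL package; no docstring in the source.) -/
theorem truncModel_def : truncModel = toyModel.truncAlg := rfl

/-- (Ported verbatim from the HodgeCMPerL package; no docstring in the source.) -/
theorem toyModel_tr_eq_zero (X : toyModel.Var) (k : ℕ) : toyModel.tr X k = 0 := rfl

/-! ### What holds -/

/-- (Ported verbatim from the HodgeCMPerL package; no docstring in the source.) -/
theorem truncModel_modelAxioms : truncModel.ModelAxioms := ModelAxioms.truncAlg toyModel_modelAxioms toyModel_tr_eq_zero

/-- (Ported verbatim from the HodgeCMPerL package; no docstring in the source.) -/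
theorem truncModel_pohlmannSpan : truncModel.PohlmannSpan :=
  (toyModel.truncAlg_pohlmannSpan_iff).mpr toyModel_pohlmannSpan'

/-- (Ported verbatim from the HodgeCMPerL package; no docstring in the source.) -/
theorem truncModel_pohlmannBasis : truncModel.PohlmannBasis :=
  (toyModel.truncAlg_pohlmannBasis_iff).mpr toyModel_pohlmannBasis'

/-- (Ported verbatim from the HodgeCMPerL package; no docstring in the source.) -/
theorem truncModel_w_rk4 : truncModel.W_RK4 := (toyModel.truncAlg_w_rk4_iff).mpr toyModel_w_rk4

/-- (Ported verbatim from the HodgeCMPerL package; no docstring in the source.) -/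
theorem truncModel_fact_cupExterior : truncModel.Fact_cupExterior :=
  (toyModel.truncAlg_fact_cupExterior_iff).mpr toyModel_fact_cupExterior
/-- (Ported verbatim from the HodgeCMPerL package; no docstring in the source.) -/
theorem truncModel_fact_cup_hodge : truncModel.Fact_cup_hodge :=
  (toyModel.truncAlg_fact_cup_hodge_iff).mpr toyModel_fact_cup_hodge
/-- (Ported verbatim from the HodgeCMPerL package; no docstring in the source.) -/
theorem truncModel_fact_pull_H0 : truncModel.Fact_pull_H0 :=
  (toyModel.truncAlg_fact_pull_H0_iff).mpr toyModel_fact_pull_H0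
/-- (Ported verbatim from the HodgeCMPerL package; no docstring in the source.) -/
theorem truncModel_fact_hodge_F0 : truncModel.Fact_hodge_F0 :=
  (toyModel.truncAlg_fact_hodge_F0_iff).mpr toyModel_fact_hodge_F0
/-- (Ported verbatim from the HodgeCMPerL package; no docstring in the source.) -/
theorem truncModel_fact_cupAssoc : truncModel.Fact_cupAssoc :=
  (toyModel.truncAlg_fact_cupAssoc_iff).mpr (fact_cupAssoc exteriorHodgeData)

/-- (Ported verbatim from the HodgeCMPerL package; no docstring in the source.) -/
theorem truncModel_lemma81 : truncModel.Lemma81 :=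
  lemma81_truncAlg toyModel_modelAxioms toyModel_fact_cupExterior toyModel_fact_cup_hodge toyModel_fact_pull_H0
    toyModel_fact_hodge_F0

/-! ### What fails -/

/-- **[QW8] Thm 2.5 (sufficiency) FAILS in `truncModel`.** -/
theorem not_truncModel_qw8Sufficiency : ¬ truncModel.Qw8Sufficiency :=
  not_qw8Sufficiency_truncAlg toyModel_modelAxioms toyModel_fact_cupExterior toyModel_w_rk4

/-- **The face reduction FAILS in `truncModel`.** -/
theorem not_truncModel_faceReduction : ¬ truncModel.FaceReduction :=
  not_faceReduction_truncAlg toyModel_modelAxioms toyModel_fact_cupExterior toyModel_fact_cup_hodge toyModel_fact_pull_H0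
    toyModel_fact_hodge_F0 toyModel_w_rk4

/-- **COR-CM FAILS in `truncModel`.** -/
theorem not_truncModel_hc_cm : ¬ truncModel.HC_CM :=
  not_hc_cm_truncAlg toyModel_modelAxioms toyModel_fact_cupExterior toyModel_fact_cup_hodge toyModel_fact_pull_H0
    toyModel_fact_hodge_F0

/-- (Ported verbatim from the HodgeCMPerL package; no docstring in the source.) -/
theorem truncModel_periodFree : truncModel.periodFree = truncModel := rfl

/-- (Ported verbatim from the HodgeCMPerL package; no docstring in the source.) -/
theorem not_truncModel_realisationExistsPerL : ¬ truncModel.RealisationExistsPerL :=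
  truncModel_periodFree ▸ truncModel.not_realisationExistsPerL_periodFree truncModel_modelAxioms.pull_hodge
/-- (Ported verbatim from the HodgeCMPerL package; no docstring in the source.) -/
theorem not_truncModel_realisationExistsFace : ¬ truncModel.RealisationExistsFace :=
  truncModel_periodFree ▸ truncModel.not_realisationExistsFace_periodFree truncModel_modelAxioms.pull_hodge
/-- (Ported verbatim from the HodgeCMPerL package; no docstring in the source.) -/
theorem not_truncModel_periodThmF : ¬ truncModel.PeriodThmF :=
  truncModel_periodFree ▸ truncModel.not_periodThmF_periodFree
/-- (Ported verbatim from the HodgeCMPerL package; no docstring in the source.) -/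
theorem not_truncModel_perL44 : ¬ truncModel.PerL44 := truncModel_periodFree ▸ truncModel.not_perL44_periodFree
/-- (Ported verbatim from the HodgeCMPerL package; no docstring in the source.) -/
theorem not_truncModel_perL : ¬ truncModel.PerL := truncModel_periodFree ▸ truncModel.not_perL_periodFree

/-- `OpenInputs` fails in `truncModel` — now at THREE of its four fields (both realisation inputs and `qw8_sufficiency`). -/
theorem not_truncModel_openInputs : ¬ truncModel.OpenInputs := fun I => not_truncModel_qw8Sufficiency I.qw8_sufficiency

/-- **The truth table of `truncModel`.** -/
theorem truncModel_profile :
    (truncModel.ModelAxioms ∧ truncModel.PohlmannSpan ∧ truncModel.PohlmannBasis ∧ truncModel.W_RK4 ∧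
        truncModel.Lemma81 ∧ truncModel.Fact_cupExterior ∧ truncModel.Fact_cup_hodge ∧ truncModel.Fact_pull_H0 ∧
        truncModel.Fact_hodge_F0 ∧ truncModel.Fact_cupAssoc) ∧
      (¬ truncModel.Qw8Sufficiency ∧ ¬ truncModel.FaceReduction ∧ ¬ truncModel.HC_CM ∧
        ¬ truncModel.RealisationExistsPerL ∧ ¬ truncModel.RealisationExistsFace ∧ ¬ truncModel.PeriodThmF ∧
        ¬ truncModel.PerL44 ∧ ¬ truncModel.PerL ∧ ¬ truncModel.OpenInputs) :=
  ⟨⟨truncModel_modelAxioms, truncModel_pohlmannSpan, truncModel_pohlmannBasis, truncModel_w_rk4, truncModel_lemma81,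
      truncModel_fact_cupExterior, truncModel_fact_cup_hodge, truncModel_fact_pull_H0, truncModel_fact_hodge_F0,
      truncModel_fact_cupAssoc⟩,
    ⟨not_truncModel_qw8Sufficiency, not_truncModel_faceReduction, not_truncModel_hc_cm,
      not_truncModel_realisationExistsPerL, not_truncModel_realisationExistsFace, not_truncModel_periodThmF,
      not_truncModel_perL44, not_truncModel_perL, not_truncModel_openInputs⟩⟩

/-! ### Independence / separation statements -/

/-- **`Qw8Sufficiency` is independent of `ModelAxioms ∧ PohlmannSpan ∧ PohlmannBasis ∧ W_RK4 ∧ Lemma81`**: both truth values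
occur (`toyModel`: true; `truncModel`: false). -/
theorem qw8Sufficiency_independent :
    (∃ U : Universe, U.ModelAxioms ∧ U.PohlmannSpan ∧ U.PohlmannBasis ∧ U.W_RK4 ∧ U.Lemma81 ∧ U.Qw8Sufficiency) ∧
      ∃ U : Universe, U.ModelAxioms ∧ U.PohlmannSpan ∧ U.PohlmannBasis ∧ U.W_RK4 ∧ U.Lemma81 ∧ ¬ U.Qw8Sufficiency :=
  ⟨⟨toyModel, toyModel_modelAxioms, toyModel_pohlmannSpan', toyModel_pohlmannBasis', toyModel_w_rk4, toyModel_lemma81,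
      toyModel_qw8Sufficiency⟩,
    ⟨truncModel, truncModel_modelAxioms, truncModel_pohlmannSpan, truncModel_pohlmannBasis, truncModel_w_rk4,
      truncModel_lemma81, not_truncModel_qw8Sufficiency⟩⟩

/-- **The open input `qw8_sufficiency` is not a consequence of the other CM-side inputs**, not even together with the
OUTPUT `W_RK4` of the two realisation inputs and the print form of Pohlmann's theorem. -/
theorem not_qw8Sufficiency_of_other_inputs :
    ¬ ∀ U : Universe, U.ModelAxioms → U.PohlmannSpan → U.PohlmannBasis → U.W_RK4 → U.Lemma81 → U.Qw8Sufficiency :=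
  fun h => not_truncModel_qw8Sufficiency
    (h truncModel truncModel_modelAxioms truncModel_pohlmannSpan truncModel_pohlmannBasis truncModel_w_rk4 truncModel_lemma81)

/-- **COR-CM is independent of the 28 model facts**: two models with opposite values. -/
theorem hc_cm_independent_of_modelAxioms :
    (∃ U : Universe, U.ModelAxioms ∧ U.HC_CM) ∧ ∃ U : Universe, U.ModelAxioms ∧ ¬ U.HC_CM :=
  ⟨⟨toyModel, toyModel_modelAxioms, toyModel_hc_cm⟩, ⟨truncModel, truncModel_modelAxioms, not_truncModel_hc_cm⟩⟩

/-- **The model facts, Pohlmann's theorem and the algebraicity of every rank-four face line do NOT imply COR-CM.** -/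
theorem not_hc_cm_of_faces_and_pohlmann :
    ¬ ∀ U : Universe, U.ModelAxioms → U.PohlmannSpan → U.PohlmannBasis → U.W_RK4 → U.HC_CM :=
  fun h => not_truncModel_hc_cm
    (h truncModel truncModel_modelAxioms truncModel_pohlmannSpan truncModel_pohlmannBasis truncModel_w_rk4)

/-- **The face reduction is independent of `ModelAxioms ∧ PohlmannSpan ∧ PohlmannBasis ∧ W_RK4 ∧ Lemma81`.** -/
theorem faceReduction_independent :
    (∃ U : Universe, U.ModelAxioms ∧ U.PohlmannSpan ∧ U.PohlmannBasis ∧ U.W_RK4 ∧ U.Lemma81 ∧ U.FaceReduction) ∧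
      ∃ U : Universe, U.ModelAxioms ∧ U.PohlmannSpan ∧ U.PohlmannBasis ∧ U.W_RK4 ∧ U.Lemma81 ∧ ¬ U.FaceReduction :=
  ⟨⟨toyModel, toyModel_modelAxioms, toyModel_pohlmannSpan', toyModel_pohlmannBasis', toyModel_w_rk4, toyModel_lemma81,
      toyModel_faceReduction⟩,
    ⟨truncModel, truncModel_modelAxioms, truncModel_pohlmannSpan, truncModel_pohlmannBasis, truncModel_w_rk4,
      truncModel_lemma81, not_truncModel_faceReduction⟩⟩

/-- **Two different models of the 28 facts** (part (6a)(i) of the consistency brief). -/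
theorem truncModel_ne_toyModel : truncModel ≠ toyModel := fun h => not_truncModel_hc_cm (h ▸ toyModel_hc_cm)

/-- (Ported verbatim from the HodgeCMPerL package; no docstring in the source.) -/
theorem exists_two_models : ∃ U U' : Universe, U.ModelAxioms ∧ U'.ModelAxioms ∧ U ≠ U' :=
  ⟨truncModel, toyModel, truncModel_modelAxioms, toyModel_modelAxioms, truncModel_ne_toyModel⟩

end HodgeCM.Toy

end
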